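import Literature.Probability.Entropy.DonskerVaradhanTransfer
import HarnessLib

/-!
# Chernoff tail bound with Hölder over shifts under an invariant probability measure

Helper file of the lead prover for the registered stub `stub_hoelderChernoff` (S4) of the line
`KineticSlabSketch` of the crux `JParityClosure.OddContactSymmetry`
(stmt-AtomisticToContinuum-17722). The line bounds a full-window statistic under a flow-invariant
law `μ` by decomposing the window into `W` slabs; slab `w` contributes `f_w ∘ T_w` with `T_w`
measure preserving and `f_w` an a.e.-measurable one-slab functional with the exponential moment
`∫ exp(W |f_w|) dμ ≤ e^B`.  This file turns the one-slab moments into the tail bound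
`μ{c ≤ ∑_{w<W} |f_w ∘ T_w|} ≤ e^{B - c}`:

* `lintegral_exp_sum_comp_le_avg_of_aemeasurable` — the a.e.-measurable form of the tree lemma
  `Literature.Probability.Entropy.lintegral_exp_sum_comp_le_avg` (HÖLDER OVER SHIFTS:
  `∫⁻ exp(∑_i f_i ∘ T_i) dμ ≤ (#s)⁻¹ ∑_i ∫⁻ exp(#s · f_i) dμ`), obtained by passing to measurable
  modifications of the `f_i` (a measure-preserving map pulls null sets back to null sets, so the
  integrands change only on null sets);
* `stub_hoelderChernoff` — CHERNOFF at unit tilt (Markov's inequality for `exp` of the sum,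
  `mul_meas_ge_le_lintegral₀`) followed by Hölder over shifts and the one-slab moments.

## References

* C. Kipnis, C. Landim, *Scaling Limits of Interacting Particle Systems* (1999), Appendix 1 §8 and
  Ch. 6 §1 (exponential-moment estimates under the invariant law; Hölder over windows).
-/

noncomputable section

open Set MeasureTheory Filter
open scoped ENNReal

namespace Summit.AtomisticToContinuum.HydrodynamicLimit.Theorems.OddContactSymmetryKineticSlab

/-- **Hölder over shifts under an invariant measure, a.e.-measurable observables.** If every `T_i`
(`i ∈ s`, `s` nonempty) preserves `μ` and the `f_i` are a.e.-measurable, then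
`∫⁻ exp(∑_{i∈s} f_i ∘ T_i) dμ ≤ (#s)⁻¹ ∑_{i∈s} ∫⁻ exp(#s · f_i) dμ`: replace each `f_i` by a
measurable modification (`AEMeasurable.mk`; `f_i ∘ T_i` changes only on the `T_i`-preimage of a null
set, which is null) and apply `Literature.Probability.Entropy.lintegral_exp_sum_comp_le_avg`.
[folklore] -/
theorem lintegral_exp_sum_comp_le_avg_of_aemeasurable {Ω : Type*} [MeasurableSpace Ω]
    {μ : Measure Ω} {ι : Type*} {s : Finset ι} {T : ι → Ω → Ω} (hs : s.Nonempty)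
    (hT : ∀ i ∈ s, MeasurePreserving (T i) μ μ) {f : ι → Ω → ℝ}
    (hf : ∀ i ∈ s, AEMeasurable (f i) μ) :
    ∫⁻ ω, ENNReal.ofReal (Real.exp (∑ i ∈ s, f i (T i ω))) ∂μ ≤
      (s.card : ℝ≥0∞)⁻¹ * ∑ i ∈ s, ∫⁻ ω, ENNReal.ofReal (Real.exp (s.card * f i ω)) ∂μ := by
  classical
  -- measurable modifications of the `f i`, `i ∈ s`
  let g : ι → Ω → ℝ := fun i => if hi : i ∈ s then (hf i hi).mk (f i) else fun _ => 0
  have hgm : ∀ i ∈ s, Measurable (g i) := fun i hi => by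
    simp only [g, dif_pos hi]
    exact (hf i hi).measurable_mk
  have hfg : ∀ i ∈ s, f i =ᵐ[μ] g i := fun i hi => by
    simp only [g, dif_pos hi]
    exact (hf i hi).ae_eq_mk
  have hfgT : ∀ i ∈ s, ∀ᵐ ω ∂μ, f i (T i ω) = g i (T i ω) := fun i hi =>
    (hT i hi).quasiMeasurePreserving.ae_eq_comp (hfg i hi)
  have hsum : (fun ω => ENNReal.ofReal (Real.exp (∑ i ∈ s, f i (T i ω)))) =ᵐ[μ]
      fun ω => ENNReal.ofReal (Real.exp (∑ i ∈ s, g i (T i ω))) := by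
    filter_upwards [(eventually_all_finset s).2 hfgT] with ω hω
    rw [Finset.sum_congr rfl hω]
  rw [lintegral_congr_ae hsum]
  refine (Literature.Probability.Entropy.lintegral_exp_sum_comp_le_avg hs hT hgm).trans_eq ?_
  refine congrArg _ (Finset.sum_congr rfl fun i hi => lintegral_congr_ae ?_)
  filter_upwards [hfg i hi] with ω hω
  rw [hω]

/-- **Chernoff with Hölder over shifts.** Under a probability measure `μ` preserved by each `T_w`
(`w < W`, `0 < W`), for a.e.-measurable `f_w` with one-slab exponential moments
`∫⁻ exp(W |f_w|) dμ ≤ e^B`, the sum over the `W` shifted slabs has the tail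
`μ{c ≤ ∑_{w<W} |f_w ∘ T_w|} ≤ e^{B - c}`: Markov for `exp` of the sum at unit tilt
(`e^c · μ{c ≤ S} ≤ ∫⁻ e^S dμ`), then Hölder over shifts
(`∫⁻ e^S dμ ≤ W⁻¹ ∑_w ∫⁻ e^{W |f_w|} dμ ≤ e^B`). [folklore] -/
theorem stub_hoelderChernoff {Ω : Type*} [MeasurableSpace Ω] (μ : Measure Ω)
    [IsProbabilityMeasure μ] {W : ℕ} (hW : 0 < W) (T : ℕ → Ω → Ω)
    (hT : ∀ w < W, MeasurePreserving (T w) μ μ) (f : ℕ → Ω → ℝ)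
    (hf : ∀ w < W, AEMeasurable (f w) μ) {B : ℝ}
    (hexp : ∀ w < W,
      ∫⁻ ω, ENNReal.ofReal (Real.exp ((W : ℝ) * |f w ω|)) ∂μ ≤ ENNReal.ofReal (Real.exp B))
    (c : ℝ) :
    μ {ω | c ≤ ∑ w ∈ Finset.range W, |f w (T w ω)|} ≤ ENNReal.ofReal (Real.exp (B - c)) := by
  have hs : (Finset.range W).Nonempty := Finset.nonempty_range_iff.2 hW.ne'
  have hT' : ∀ w ∈ Finset.range W, MeasurePreserving (T w) μ μ := fun w hw =>
    hT w (Finset.mem_range.1 hw)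
  have hf' : ∀ w ∈ Finset.range W, AEMeasurable (fun ω => |f w ω|) μ := fun w hw =>
    (hf w (Finset.mem_range.1 hw)).norm
  -- the slab sum `S` is a.e.-measurable
  set S : Ω → ℝ := fun ω => ∑ w ∈ Finset.range W, |f w (T w ω)| with hS_def
  have hSm : AEMeasurable S μ := Finset.aemeasurable_fun_sum (Finset.range W) fun w hw =>
    (hf' w hw).comp_quasiMeasurePreserving (hT' w hw).quasiMeasurePreserving
  -- Hölder over shifts and the one-slab moments
  have hH : ∫⁻ ω, ENNReal.ofReal (Real.exp (S ω)) ∂μ ≤ ENNReal.ofReal (Real.exp B) := by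
    calc ∫⁻ ω, ENNReal.ofReal (Real.exp (S ω)) ∂μ
        ≤ ((Finset.range W).card : ℝ≥0∞)⁻¹ * ∑ w ∈ Finset.range W,
            ∫⁻ ω, ENNReal.ofReal (Real.exp ((Finset.range W).card * |f w ω|)) ∂μ :=
          lintegral_exp_sum_comp_le_avg_of_aemeasurable hs hT' hf'
      _ ≤ ((Finset.range W).card : ℝ≥0∞)⁻¹ * ∑ w ∈ Finset.range W, ENNReal.ofReal (Real.exp B) := by
          rw [Finset.card_range]
          gcongr with w hw
          exact hexp w (Finset.mem_range.1 hw)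
      _ = ENNReal.ofReal (Real.exp B) := by
          rw [Finset.sum_const, Finset.card_range, nsmul_eq_mul, ← mul_assoc,
            ENNReal.inv_mul_cancel (by exact_mod_cast hW.ne') (ENNReal.natCast_ne_top _), one_mul]
  -- Chernoff at unit tilt
  have hM : ENNReal.ofReal (Real.exp c) * μ {ω | c ≤ S ω} ≤ ENNReal.ofReal (Real.exp B) := by
    calc ENNReal.ofReal (Real.exp c) * μ {ω | c ≤ S ω}
        ≤ ENNReal.ofReal (Real.exp c) *
            μ {ω | ENNReal.ofReal (Real.exp c) ≤ ENNReal.ofReal (Real.exp (S ω))} := by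
          refine mul_le_mul' le_rfl (measure_mono fun ω hω => ?_)
          exact ENNReal.ofReal_le_ofReal (Real.exp_le_exp.2 hω)
      _ ≤ ∫⁻ ω, ENNReal.ofReal (Real.exp (S ω)) ∂μ :=
          mul_meas_ge_le_lintegral₀ hSm.exp.ennreal_ofReal _
      _ ≤ ENNReal.ofReal (Real.exp B) := hH
  -- divide by `e^c`
  calc μ {ω | c ≤ S ω}
      = ENNReal.ofReal (Real.exp (-c)) * (ENNReal.ofReal (Real.exp c) * μ {ω | c ≤ S ω}) := by
        rw [← mul_assoc, ← ENNReal.ofReal_mul (Real.exp_pos _).le, ← Real.exp_add, neg_add_cancel,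
          Real.exp_zero, ENNReal.ofReal_one, one_mul]
    _ ≤ ENNReal.ofReal (Real.exp (-c)) * ENNReal.ofReal (Real.exp B) := by gcongr
    _ = ENNReal.ofReal (Real.exp (B - c)) := by
        rw [← ENNReal.ofReal_mul (Real.exp_pos _).le, ← Real.exp_add, neg_add_eq_sub]

end Summit.AtomisticToContinuum.HydrodynamicLimit.Theorems.OddContactSymmetryKineticSlab

end
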